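import Summits.HubbardSuperconductivity.HubbardSuperconductivity.Theorems.AnisotropyChordTransferFibre3RowDLoopWSNorms
import Summits.HubbardSuperconductivity.HubbardSuperconductivity.Theorems.AnisotropyChordTransferFibre3RowDLoopWMajE

/-!
# Route `AnisotropyChord` / H0 rotor rung, row D (KT-2a) STAGE 2: the loop majorant with the CERTIFIED-TABLE `SSS` N-term, as `RExpr`

p1 g31's generic program (`…RowDLoopWMajE`: `majNEC czE`, `majLoopEC`, `majEC`, `monoLoop_leC`, `loopTot_leC`, `rhat_norm_leC`) bounds the
N-loop of EVERY monomial by the zone family `c·S₂`-type tables.  THIS FILE replaces the N-majorant of the `(S,S,S)` monomial — 95 % of the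
row-D majorant at `ν = .03` — by the Stage-2 certified-table term of `…RowDLoopWSNorms`:
* ★ `sssTabE ws k₂ k₃ = cs³·K3E·½·Σ_{translates j}Σ_{e∈E4}[√(ws e a·ws e (−b)) + √(ws e (−b)·ws e (−(a+b))) + √(ws e (−a)·ws e (−(a+b)))]`
  (`(a,b)` = `(k₂,k₃)`, `(k₂−x̂,k₃)`, `(k₂,k₃−x̂)`; `ws : ℤ×ℤ → ℤ×ℤ → ℚ` a certified table such as `B1.wsTabB<band>`), ★ `eval_sssTabE`,
  ★ `norm_nvLoopU_SSS_le_tabE`: `‖nvLoopU S S S e0 k̄₂ k̄₃‖ ≤ V²t·(sssTabE ws k₂ k₃).eval xTrueD` under the table hypothesis `hws`;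
* `majNEX czE ws` (table term for `(S,S,S)`, `majNEC czE` otherwise), `majLoopEX`, ★ `majEX`; ★ `monoLoop_leX`, ★ `loopTot_leX`,
  ★★ `rhat_norm_leX`: `‖R̂′(k̄)‖ ≤ V²t·(|x_k| + majEX.eval)` — p1's `rhat_norm_leC` with the Stage-2 loop majorant.
The table hypothesis `hws kk : ∀ e ∈ E4, ∀ d ∈ sssShifts kk, θ⁴·B1.wloopSum L λ₂ 0 d d e e ≤ ws e d` is discharged per cell from
`B1.wsTabB<band>_adm` and `B1.wsDSetB<band>_covers` (`…B1WTabB<band>`); the cell program is `…RowDCellCheckX`.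
Prover seat `hubbard-h0-rotor-p2` g7; helper for piece A = stmt-HubbardSuperconductivity-23918 of rung 19089
(`--supports`, helper class).  Nothing here proves superconductivity in the Hubbard model; lemmas for ONE row of ONE conditional reduction;
the rotor TARGET as originally worded stays FALSE (g15 verdict).  Tree imports only; no sorry.
-/

set_option linter.dupNamespace false
set_option autoImplicit false

open scoped BigOperators
open Literature.Analysis.ValidatedNumerics

namespace Summit.HubbardSuperconductivity.HubbardSuperconductivity.Theorems.AnisotropyChord.Transfer.Fibre3

namespace RowD

open RowC L2.N1

variable (L : ℕ) [NeZero L]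

/-! ## The table term -/

/-- the three `K₁`-translates of a class. -/
def translates (k₂ k₃ : ℤ × ℤ) : List ((ℤ × ℤ) × (ℤ × ℤ)) := [(k₂, k₃), (k₂ - (1, 0), k₃), (k₂, k₃ - (1, 0))]

/-- the twelve shifts of a class whose `WS` values the table must cover (per translate: `a, −b, −a, −(a+b)`). -/
def sssShifts (kk : (ℤ × ℤ) × (ℤ × ℤ)) : List (ℤ × ℤ) :=
  [kk.1, -kk.2, -kk.1, -(kk.1 + kk.2)] ++ [kk.1 - (1, 0), -kk.2, -(kk.1 - (1, 0)), -(kk.1 - (1, 0) + kk.2)]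
    ++ [kk.1, -(kk.2 - (1, 0)), -kk.1, -(kk.1 + (kk.2 - (1, 0)))]

/-- one translate's bracket of square roots: `Σ_{e∈E4} [√(ws e a·ws e (−b)) + √(ws e (−b)·ws e (−(a+b))) + √(ws e (−a)·ws e (−(a+b)))]`. -/
def sqrtSumE (ws : ℤ × ℤ → ℤ × ℤ → ℚ) (ab : (ℤ × ℤ) × (ℤ × ℤ)) : RExpr :=
  sumE (E4.map fun e =>
    .add (.add (.sqrt (cst (ws e ab.1 * ws e (-ab.2)))) (.sqrt (cst (ws e (-ab.2) * ws e (-(ab.1 + ab.2))))))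
      (.sqrt (cst (ws e (-ab.1) * ws e (-(ab.1 + ab.2))))))

/-- ★ the Stage-2 `(S,S,S)` N-majorant `/(V³t)` of the class `(k₂,k₃)` from a certified table `ws`:
`cs³·K3E·½·Σ_{translates} sqrtSumE`. -/
def sssTabE (ws : ℤ × ℤ → ℤ × ℤ → ℚ) (k₂ k₃ : ℤ × ℤ) : RExpr :=
  .mul (.mul (.mul (.mul cs cs) cs) K3E) (.mul (cst (1 / 2)) (sumE ((translates k₂ k₃).map (sqrtSumE ws))))

/-! ## The Stage-2 majorants -/

/-- the N-part majorant of a monomial: the table term for `(S,S,S)`, p1's generic zone table otherwise. -/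
def majNEX (czE : RExpr) (ws : ℤ × ℤ → ℤ × ℤ → ℚ) (k3 k1 k2 : Bool) (k₂ k₃ : ℤ × ℤ) : RExpr :=
  if k3 ∧ k1 ∧ k2 then sssTabE ws k₂ k₃ else majNEC czE k3 k1 k2

/-- ★ the Stage-2 loop majorant of the class `(k₂,k₃)`. -/
def majLoopEX (czE : RExpr) (ws : ℤ × ℤ → ℤ × ℤ → ℚ) (k₂ k₃ : ℤ × ℤ) : RExpr :=
  sumE (monoList.map (fun m => .add (.add (majNEX czE ws m.2.2 m.1 m.2.1 k₂ k₃) (majME m.2.2 m.1 m.2.1 k₂ k₃)) (majBEC czE m.2.2 m.1 m.2.1)))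

/-- ★ THE STAGE-2 MAJORANT of the class `(k₂,k₃)`. -/
def majEX (czE : RExpr) (ws : ℤ × ℤ → ℤ × ℤ → ℚ) (τlo τhi : ℚ) (k₂ k₃ : ℤ × ℤ) : RExpr :=
  .add (majLoopEX czE ws k₂ k₃) (majNTE τlo τhi k₂ k₃)

/-! ## Evaluation of the table term -/

section evals
variable (Δ lam2 : ℝ) (f : Tor L → ℝ)

/-- the table read in `ℝ`. -/
def wsR (ws : ℤ × ℤ → ℤ × ℤ → ℚ) : ℤ × ℤ → ℤ × ℤ → ℝ := fun e d => ((ws e d : ℚ) : ℝ)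

omit [NeZero L] in
/-- one translate: `cS³ · (sqrtSumE ws (a,b)).eval x = Σ_{e∈E4} sssConst cS (wsR ws) a b e`. [folklore] -/
theorem eval_sqrtSumE (ws : ℤ × ℤ → ℤ × ℤ → ℚ) (ab : (ℤ × ℤ) × (ℤ × ℤ)) (x : ℕ → ℝ) (c : ℝ) :
    c ^ 3 * (sqrtSumE ws ab).eval x = (E4.map fun e => sssConst c (wsR ws) ab.1 ab.2 e).sum := by
  unfold sqrtSumE
  rw [eval_sumE]
  simp only [E4, List.map, List.sum_cons, List.sum_nil, RExpr.eval, cst, sssConst, wsR]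
  push_cast
  ring_nf

/-- ★ `V²t · (sssTabE ws k₂ k₃).eval xTrueD = (½·Σ_{translates}Σ_e sssConst c_s ws a b e)/(θ⁴·V)`. [folklore] -/
theorem eval_sssTabE (hL : 128 ≤ L) (hΔ0 : 0 ≤ Δ) (hΔ1 : Δ < 1) (hf : IsGroundTwoMagnon L Δ lam2 f)
    (ws : ℤ × ℤ → ℤ × ℤ → ℚ) (k₂ k₃ : ℤ × ℤ) :
    ((L : ℝ) ^ 2) ^ 2 * (2 * Real.pi / L) ^ 2 * (sssTabE ws k₂ k₃).eval (xTrueD L Δ lam2 f)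
      = (1 / 2) * ((translates k₂ k₃).map fun ab =>
          (E4.map fun e => sssConst (cS L Δ lam2 f) (wsR ws) ab.1 ab.2 e).sum).sum
          / ((2 * Real.pi / L) ^ 2) ^ 2 / (L : ℝ) ^ 2 := by
  obtain ⟨h0, _, _, _, hcs, _, _, _, hK3, hV⟩ := atom_facts L Δ lam2 f hL hΔ0 hΔ1 hf
  have hLpos : (0 : ℝ) < L := by exact_mod_cast (show 0 < L by omega)
  have ht : 0 < (2 * Real.pi / L : ℝ) ^ 2 := by positivity
  have hpi := Real.pi_pos
  have hsum : ∀ l : List ((ℤ × ℤ) × (ℤ × ℤ)),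
      (cS L Δ lam2 f) ^ 3 * (sumE (l.map (sqrtSumE ws))).eval (xTrueD L Δ lam2 f)
        = (l.map fun ab => (E4.map fun e => sssConst (cS L Δ lam2 f) (wsR ws) ab.1 ab.2 e).sum).sum := by
    intro l
    induction l with
    | nil => simp [sumE, cst, RExpr.eval]
    | cons ab l ih =>
      rw [List.map_cons, sumE, RExpr.eval, mul_add, ih, eval_sqrtSumE, List.map_cons, List.sum_cons]
  have e1 : (sssTabE ws k₂ k₃).eval (xTrueD L Δ lam2 f)
      = (1 / (4 * Real.pi ^ 2) ^ 3) * ((1 / 2) * ((cS L Δ lam2 f) ^ 3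
          * (sumE ((translates k₂ k₃).map (sqrtSumE ws))).eval (xTrueD L Δ lam2 f))) := by
    simp only [sssTabE, RExpr.eval, cst, hcs, hK3]
    push_cast
    ring
  rw [e1, hsum, hV]
  field_simp

/-- ★ the table bound of the `(S,S,S)` N-loop in program units: `‖nvLoopU S S S e0 k̄₂ k̄₃‖ ≤ V²t·(sssTabE ws k₂ k₃).eval xTrueD`. [folklore] -/
theorem norm_nvLoopU_SSS_le_tabE (hL : 128 ≤ L) (hΔ0 : 0 ≤ Δ) (hΔ1 : Δ < 1) (hf : IsGroundTwoMagnon L Δ lam2 f)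
    (e0 : Tor L) (ws : ℤ × ℤ → ℤ × ℤ → ℚ) (k₂ k₃ : ℤ × ℤ)
    (hws : ∀ e ∈ E4, ∀ d ∈ sssShifts (k₂, k₃), ((2 * Real.pi / L) ^ 2) ^ 2 * B1.wloopSum L lam2 0 d d e e ≤ wsR ws e d) :
    ‖nvLoopU L Δ lam2 f true true true e0 (B1.toTor L k₂) (B1.toTor L k₃)‖
      ≤ ((L : ℝ) ^ 2) ^ 2 * (2 * Real.pi / L) ^ 2 * (sssTabE ws k₂ k₃).eval (xTrueD L Δ lam2 f) := by
  rw [eval_sssTabE L Δ lam2 f hL hΔ0 hΔ1 hf]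
  have h0 : ∀ e ∈ E4, ∀ d ∈ [k₂, -k₃, -k₂, -(k₂ + k₃)],
      ((2 * Real.pi / L) ^ 2) ^ 2 * B1.wloopSum L lam2 0 d d e e ≤ wsR ws e d :=
    fun e he d hd => hws e he d (by unfold sssShifts; simp only [List.mem_append]; exact Or.inl (Or.inl hd))
  have h1 : ∀ e ∈ E4, ∀ d ∈ [k₂ - (1, 0), -k₃, -(k₂ - (1, 0)), -(k₂ - (1, 0) + k₃)],
      ((2 * Real.pi / L) ^ 2) ^ 2 * B1.wloopSum L lam2 0 d d e e ≤ wsR ws e d :=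
    fun e he d hd => hws e he d (by unfold sssShifts; simp only [List.mem_append]; exact Or.inl (Or.inr hd))
  have h2 : ∀ e ∈ E4, ∀ d ∈ [k₂, -(k₃ - (1, 0)), -k₂, -(k₂ + (k₃ - (1, 0)))],
      ((2 * Real.pi / L) ^ 2) ^ 2 * B1.wloopSum L lam2 0 d d e e ≤ wsR ws e d :=
    fun e he d hd => hws e he d (by unfold sssShifts; simp only [List.mem_append]; exact Or.inr hd)
  have h := norm_nvLoopU_SSS_le_WS L Δ lam2 f hL hΔ0 hΔ1 hf e0 k₂ k₃ (wsR ws) h0 h1 h2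
  refine h.trans (le_of_eq ?_)
  simp only [translates, List.map, List.sum_cons, List.sum_nil]
  ring

end evals

/-! ## The bounds -/

section bound
variable (Δ lam2 : ℝ) (f : Tor L → ℝ)

/-- ★ one monomial, Stage 2: `‖monoLoopU(k̄)‖ ≤ V²t·(majNEX + majME + majBEC).eval`. [folklore] -/
theorem monoLoop_leX (czE : RExpr) {cz : ℝ} (hc : 0 ≤ cz)
    (hwg : ∀ q : Tor L, ∀ e ∈ E4, (wnorm L q (B1.toTor L e) * gres L lam2 q) ^ 2 ≤ cz * gres L lam2 q)
    (hcz : czE.eval (xTrueD L Δ lam2 f) = cz) (hL : 128 ≤ L) (hΔ0 : 0 ≤ Δ) (hΔ1 : Δ < 1) (hf : IsGroundTwoMagnon L Δ lam2 f) (e0 : Tor L)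
    (ws : ℤ × ℤ → ℤ × ℤ → ℚ) (k3 k1 k2 : Bool) (k₂ k₃ : ℤ × ℤ)
    (hws : ∀ e ∈ E4, ∀ d ∈ sssShifts (k₂, k₃), ((2 * Real.pi / L) ^ 2) ^ 2 * B1.wloopSum L lam2 0 d d e e ≤ wsR ws e d) :
    ‖monoLoopU L Δ lam2 f e0 k3 k1 k2 (B1.toTor L k₂) (B1.toTor L k₃)‖
      ≤ ((L : ℝ) ^ 2) ^ 2 * (2 * Real.pi / L) ^ 2 *
        (RExpr.add (.add (majNEX czE ws k3 k1 k2 k₂ k₃) (majME k3 k1 k2 k₂ k₃)) (majBEC czE k3 k1 k2)).eval (xTrueD L Δ lam2 f) := by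
  by_cases hS : k3 ∧ k1 ∧ k2
  · -- the `(S,S,S)` monomial: table for the N-part, p1's bounds for the M- and boundary parts
    obtain ⟨r3, r1, r2⟩ := hS
    subst r3; subst r1; subst r2
    have hLpos : (0 : ℝ) < L := by exact_mod_cast (show 0 < L by omega)
    have hθ : 0 < (2 * Real.pi / L : ℝ) := by positivity
    have hV : (0 : ℝ) < (L : ℝ) ^ 2 := by positivity
    have hN := norm_nvLoopU_SSS_le_tabE L Δ lam2 f hL hΔ0 hΔ1 hf e0 ws k₂ k₃ hws
    have hM := norm_mLoopU_le L Δ lam2 f hL hΔ0 hΔ1 hf true true true e0 k₂ k₃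
    have hB := norm_bLoopU_leC L Δ lam2 f hc hwg hL hΔ0 hΔ1 hf true true true (B1.toTor L k₂) (B1.toTor L k₃)
    have eM := eval_bndME L Δ lam2 f hL hΔ0 hΔ1 hf true true true
    have epg := fun (a b : Bool) => eval_bpgEC L Δ lam2 f czE hcz hL hΔ0 hΔ1 hf a b
    have esp := fun (a b : Bool) => eval_bspE L Δ lam2 f hL hΔ0 hΔ1 hf a b
    have epv := fun (k : Bool) => eval_pvE L Δ lam2 f k
    have hsqrt : Real.sqrt (xTrueD L Δ lam2 f 0) = 2 * Real.pi / L := by rw [xTrueD_zero, Real.sqrt_sq hθ.le]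
    have hline : ∀ x y : Bool, ((L : ℝ) ^ 2) ^ 2 * (2 * Real.pi / L) ^ 2 * (lineBndEC czE x y).eval (xTrueD L Δ lam2 f)
        = lineBndC L Δ lam2 f cz x y / (L : ℝ) ^ 2 := by
      intro x y
      simp only [lineBndEC, RExpr.eval, cst, vT, epg, esp, hsqrt]
      unfold lineBndC
      push_cast
      field_simp
    have hME : ((L : ℝ) ^ 2) ^ 2 * (2 * Real.pi / L) ^ 2 * (majME true true true k₂ k₃).eval (xTrueD L Δ lam2 f)
        = (2 * Real.pi / L) ^ 2 * (mMult k₂ k₃ : ℝ) * (bndMAt L Δ lam2 f true true true / (L : ℝ) ^ 2) := by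
      simp only [majME, RExpr.eval, cst, eM]
      push_cast
      field_simp
    have hBE : ((L : ℝ) ^ 2) ^ 2 * (2 * Real.pi / L) ^ 2 * (majBEC czE true true true).eval (xTrueD L Δ lam2 f)
        = (pvR L Δ lam2 f true * lineBndC L Δ lam2 f cz true true + pvR L Δ lam2 f true * lineBndC L Δ lam2 f cz true true
            + pvR L Δ lam2 f true * lineBndC L Δ lam2 f cz true true) / (L : ℝ) ^ 2 := by
      have h1 := hline true true
      simp only [majBEC, RExpr.eval, epv]
      linear_combination (pvR L Δ lam2 f true) * h1 + (pvR L Δ lam2 f true) * h1 + (pvR L Δ lam2 f true) * h1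
    have hNX : majNEX czE ws true true true k₂ k₃ = sssTabE ws k₂ k₃ := by
      unfold majNEX; simp
    unfold monoLoopU
    calc ‖nvLoopU L Δ lam2 f true true true e0 (B1.toTor L k₂) (B1.toTor L k₃) + mLoopU L Δ lam2 f true true true e0 (B1.toTor L k₂) (B1.toTor L k₃)
          - bLoopU L Δ lam2 f true true true (B1.toTor L k₂) (B1.toTor L k₃)‖
        ≤ ‖nvLoopU L Δ lam2 f true true true e0 (B1.toTor L k₂) (B1.toTor L k₃)‖ + ‖mLoopU L Δ lam2 f true true true e0 (B1.toTor L k₂) (B1.toTor L k₃)‖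
          + ‖bLoopU L Δ lam2 f true true true (B1.toTor L k₂) (B1.toTor L k₃)‖ := by
          refine (norm_sub_le _ _).trans ?_; gcongr; exact norm_add_le _ _
      _ ≤ _ := by
          rw [RExpr.eval, RExpr.eval, mul_add, mul_add, hNX, hME, hBE]
          linarith
  · -- any other monomial: p1's generic bound verbatim
    have hNX : majNEX czE ws k3 k1 k2 k₂ k₃ = majNEC czE k3 k1 k2 := by
      unfold majNEX; rw [if_neg hS]
    rw [hNX]
    exact monoLoop_leC L Δ lam2 f czE hc hwg hcz hL hΔ0 hΔ1 hf e0 k3 k1 k2 k₂ k₃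

/-- ★ the total loop part, Stage 2: `‖loopTot(k̄)‖ ≤ V²t·(majLoopEX czE ws k).eval`. [folklore] -/
theorem loopTot_leX (czE : RExpr) {cz : ℝ} (hc : 0 ≤ cz)
    (hwg : ∀ q : Tor L, ∀ e ∈ E4, (wnorm L q (B1.toTor L e) * gres L lam2 q) ^ 2 ≤ cz * gres L lam2 q)
    (hcz : czE.eval (xTrueD L Δ lam2 f) = cz) (hL : 128 ≤ L) (hΔ0 : 0 ≤ Δ) (hΔ1 : Δ < 1) (hf : IsGroundTwoMagnon L Δ lam2 f) (e0 : Tor L)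
    (ws : ℤ × ℤ → ℤ × ℤ → ℚ) (k₂ k₃ : ℤ × ℤ)
    (hws : ∀ e ∈ E4, ∀ d ∈ sssShifts (k₂, k₃), ((2 * Real.pi / L) ^ 2) ^ 2 * B1.wloopSum L lam2 0 d d e e ≤ wsR ws e d) :
    ‖loopTot L Δ lam2 f e0 (B1.toTor L k₂) (B1.toTor L k₃)‖
      ≤ ((L : ℝ) ^ 2) ^ 2 * (2 * Real.pi / L) ^ 2 * (majLoopEX czE ws k₂ k₃).eval (xTrueD L Δ lam2 f) := by
  have T := fun (k3 k1 k2 : Bool) => monoLoop_leX L Δ lam2 f czE hc hwg hcz hL hΔ0 hΔ1 hf e0 ws k3 k1 k2 k₂ k₃ hws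
  unfold loopTot majLoopEX
  rw [eval_sumE]
  simp only [monoList, List.map, List.sum_cons, List.sum_nil, add_zero, mul_add]
  have e1 := T true false false; have e2 := T false false true; have e3 := T true false true
  have e4 := T false true false; have e5 := T true true false; have e6 := T false true true; have e7 := T true true true
  exact norm_add_le_of_le e1 (norm_add_le_of_le e2 (norm_add_le_of_le e3 (norm_add_le_of_le e4
    (norm_add_le_of_le e5 (norm_add_le_of_le e6 e7)))))

end bound

end RowD

end Summit.HubbardSuperconductivity.HubbardSuperconductivity.Theorems.AnisotropyChord.Transfer.Fibre3
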